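import Summits.ResolutionOfSingularities.ResolutionOfSingularities.Theorems.RisoStrataRisoCentresResolveReduction
import Summits.ResolutionOfSingularities.ResolutionOfSingularities.Theorems.RisoStrataRisoCentresResolveHidden
import Summits.ResolutionOfSingularities.ResolutionOfSingularities.Theorems.RisoStrataRisoCurvesLoc
import Literature.AlgebraicGeometry.Resolution.QuadraticSequenceDimOneExistence
import Literature.AlgebraicGeometry.Resolution.NormalizationOfVarietiesProofs
import Literature.AlgebraicGeometry.Resolution.InseparableLocalUniformization

/-!
# Route RisoStrata — crux `RisoCentresResolve` (stmt-ResolutionOfSingularities-18546), line `Sketch` v4: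
# stub `stub_rcrCurveAssembly` (curve case: assembly of riso local uniformization for `trdeg ≤ 1`)

From the two curve lemmas of the line, taken as hypotheses —
`hStep` (the riso step at a singular centre of a one-dimensional chart, localised at the centre of
`O`, is a quadratic transform along `O`) and `hReach` (a sequence of quadratic transforms along a
non-trivial `O` starting at the local ring of an affine curve with fraction field `K` reaches `O`,
a discrete valuation ring) — we assemble riso local uniformization along the CONSTANT TOP WORD
`w ≡ N` for presentations `K = k(hᵢ/hⱼ)` (`h : Fin (N+1) → K`) of transcendence degree `≤ 1`.

Proof (generic in the cut predicate `P`, `curveAssembly_generic`; the route's inline rtd-cut is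
plugged in at the very end, its only used property being that it holds at every maximal ideal for
the top letter `N`, `hidden_cut_of_le`):
* chart `B₀ = k[hᵢ/hⱼ] ⊆ O` with `ν(hⱼ)` minimal (`curveAssembly_exists_chart`); `Frac B₀ = K`
  (`curveAssembly_frac`); every `k`-subalgebra of `K` has Krull dimension `≤ 1`
  (`curveAssembly_ringKrullDim_le`, transcendence degree bounds chains of primes);
* `O = ⊤`: the local ring of `B₀` at the centre of `⊤` is a field, hence regular, at stage `0`
  (`curveAssembly_regular_top`);
* `O ≠ ⊤` (`curveAssembly_tower`): choose once and for all an admissible denominator for every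
  finitely generated chart inside `O` (`rcr_exists_risoValid`) and build the recursive tower
  `T 0 = B₀`, `T (t+1) = (T t)[Cen/x_t]`; its stages are the riso stages along the constant word.
  If no `risoLoc O (T t)` were regular, `t ↦ risoLoc O (T t)` would be an infinite sequence of
  quadratic transforms along `O` (`hStep`), which reaches `O` (`hReach`), a discrete valuation
  ring — regular; contradiction.
-/

noncomputable section

set_option linter.dupNamespace false -- mandated namespace of this single-conjunct summit

namespace Summit.ResolutionOfSingularities.ResolutionOfSingularities.Theorems

open Summit.ResolutionOfSingularities.ResolutionOfSingularities.Theses.RisoStrata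
open Literature.AlgebraicGeometry.Resolution IsLocalRing

/-! ## Generic ingredients (any cut predicate `P`) -/

section Generic

variable {k K : Type} [Field k] [Field K] [Algebra k K]

/-- **Chart of minimal value**: for nonzero `h₀, …, h_N` and a valuation ring `O` of `K`, some
`j` has `hᵢ/hⱼ ∈ O` for all `i` (take `ν(hⱼ)` minimal). [folklore] -/
theorem curveAssembly_exists_chart (O : ValuationSubring K) {N : ℕ} (h : Fin (N + 1) → K)
    (hh : ∀ i, h i ≠ 0) : ∃ j : Fin (N + 1), ∀ i, h i * (h j)⁻¹ ∈ O := by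
  obtain ⟨j, -, -, hmax⟩ :=
    exists_max_valuation O Finset.univ h ⟨0, Finset.mem_univ _, hh 0⟩
  have hv0 : O.valuation (h j) ≠ 0 := by simpa using hh j
  refine ⟨j, fun i => ?_⟩
  rw [← O.valuation_le_one_iff, map_mul, map_inv₀]
  calc O.valuation (h i) * (O.valuation (h j))⁻¹
      ≤ O.valuation (h j) * (O.valuation (h j))⁻¹ := by
        gcongr
        exact hmax i (Finset.mem_univ i)
    _ = 1 := mul_inv_cancel₀ hv0

/-- The chart `k[hᵢ/hⱼ : i]` is a finitely generated `k`-algebra. [folklore] -/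
theorem curveAssembly_chart_fg {N : ℕ} (h : Fin (N + 1) → K) (j : Fin (N + 1)) :
    (Algebra.adjoin k (Set.range fun i => h i * (h j)⁻¹)).FG := by
  classical
  refine ⟨Finset.univ.image fun i => h i * (h j)⁻¹, ?_⟩
  rw [Finset.coe_image, Finset.coe_univ, Set.image_univ]

/-- **The chart has fraction field `K`**: if the ratios `h_a/h_b` generate `K` over `k` as a
field, every `z ∈ K` is a quotient of two elements of `k[hᵢ/hⱼ : i]`
(`h_a/h_b = (h_a/h_j)·(h_b/h_j)⁻¹`). [folklore] -/
theorem curveAssembly_frac {N : ℕ} (h : Fin (N + 1) → K) (hh : ∀ i, h i ≠ 0)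
    (hgen : IntermediateField.adjoin k
      (Set.range fun ij : Fin (N + 1) × Fin (N + 1) => h ij.1 * (h ij.2)⁻¹) = ⊤)
    (j : Fin (N + 1)) (z : K) :
    ∃ a ∈ Algebra.adjoin k (Set.range fun i => h i * (h j)⁻¹),
      ∃ b ∈ Algebra.adjoin k (Set.range fun i => h i * (h j)⁻¹), b ≠ 0 ∧ z = a / b := by
  have hmem : ∀ i, h i * (h j)⁻¹ ∈
      IntermediateField.adjoin k (Set.range fun i => h i * (h j)⁻¹) := fun i =>
    IntermediateField.subset_adjoin k _ ⟨i, rfl⟩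
  have htop : IntermediateField.adjoin k (Set.range fun i => h i * (h j)⁻¹) = ⊤ := by
    refine top_le_iff.mp ?_
    rw [← hgen, IntermediateField.adjoin_le_iff]
    rintro _ ⟨⟨a, b⟩, rfl⟩
    have heq : h a * (h b)⁻¹ = (h a * (h j)⁻¹) * (h b * (h j)⁻¹)⁻¹ := by
      field_simp [hh b, hh j]
    show h a * (h b)⁻¹ ∈ IntermediateField.adjoin k (Set.range fun i => h i * (h j)⁻¹)
    rw [heq]
    exact mul_mem (hmem a) (inv_mem (hmem b))
  have hz : z ∈ IntermediateField.adjoin k (Set.range fun i => h i * (h j)⁻¹) := by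
    rw [htop]; exact IntermediateField.mem_top
  obtain ⟨r, hr, s, hs, rfl⟩ := IntermediateField.mem_adjoin_iff_div.mp hz
  by_cases hs0 : s = 0
  · exact ⟨0, Subalgebra.zero_mem _, 1, Subalgebra.one_mem _, one_ne_zero,
      by rw [hs0, div_zero, zero_div]⟩
  · exact ⟨r, hr, s, hs, hs0, rfl⟩

/-- **Curves have one-dimensional charts**: if `trdeg_k K ≤ 1`, every `k`-subalgebra of `K` has
Krull dimension `≤ 1` (transcendence degree is monotone and bounds chains of primes,
`ringKrullDim_le_of_trdeg_le`). [folklore] -/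
theorem curveAssembly_ringKrullDim_le (htr : Algebra.trdeg k K ≤ 1) (B : Subalgebra k K) :
    ringKrullDim ↥B ≤ 1 := by
  have h1 : Algebra.trdeg k ↥B ≤ Algebra.trdeg k K :=
    trdeg_le_of_injective B.val Subtype.val_injective
  have h2 : Algebra.trdeg k ↥B ≤ (1 : ℕ) := by
    rw [Nat.cast_one]; exact h1.trans htr
  have h3 := ringKrullDim_le_of_trdeg_le h2
  rwa [Nat.cast_one] at h3

/-- **The trivial valuation ring**: the local ring of any `B` at the centre of `O = ⊤ = K` is
closed under inverses, hence a field, hence a regular local ring. [folklore] -/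
theorem curveAssembly_regular_top (B : Subalgebra k K) :
    IsRegularLocalRing ↥(risoLoc (⊤ : ValuationSubring K) B) := by
  have hBO : B.toSubring ≤ (⊤ : ValuationSubring K).toSubring := fun y _ =>
    ValuationSubring.mem_top y
  have hF : IsField ↥(risoLoc (⊤ : ValuationSubring K) B) := by
    refine ⟨⟨0, 1, zero_ne_one⟩, mul_comm, fun {a} ha => ?_⟩
    have ha0 : (a : K) ≠ 0 := fun h0 => ha (Subtype.ext h0)
    exact ⟨⟨(a : K)⁻¹, inv_mem_risoLoc hBO a.2 (ValuationSubring.mem_top _)⟩,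
      Subtype.ext (mul_inv_cancel₀ ha0)⟩
  letI := hF.toField
  infer_instance

/-- **The everywhere-admissible tower along a non-trivial valuation ring reaches a regular local
ring** (`trdeg ≤ 1`, i.e. all charts of dimension `≤ 1`; cut predicate `P` holding at every
maximal ideal for the letter `N`). Choose an admissible denominator for every finitely generated
chart inside `O` and iterate the riso step from `B₀`; the stages along the constant word `N` are
these iterates. If none of their local rings at the centre of `O` were regular, these local rings
would form an infinite sequence of quadratic transforms along `O` (`hStep`), which by `hReach`
reaches the discrete valuation ring `O` — a regular local ring: contradiction. [folklore] -/
theorem curveAssembly_tower [IsAlgClosed k]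
    (hStep : ∀ (P : ∀ B : Subalgebra k K, Ideal ↥B → ℕ → Prop) (d : ℕ)
      (B : Subalgebra k K), B.FG → ringKrullDim ↥B ≤ 1 →
      (∀ m : Ideal ↥B, m.IsMaximal → P B m d) →
      ∀ (O : ValuationSubring K), B.toSubring ≤ O.toSubring →
      ¬ IsRegularLocalRing ↥(risoLoc O B) → ∀ xt : K, risoValid P O B d xt →
      IsQuadraticTransformAlong O (risoLoc O B).toSubring
        (risoLoc O (risoStep P B d xt)).toSubring)
    (hReach : ∀ (B : Subalgebra k K), B.FG →
      (∀ z : K, ∃ a ∈ B, ∃ b ∈ B, b ≠ 0 ∧ z = a / b) → ringKrullDim ↥B ≤ 1 →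
      ∀ (O : ValuationSubring K), B.toSubring ≤ O.toSubring → O ≠ ⊤ →
      ∀ A : ℕ → Subring K, A 0 = locAtCentre B.toSubring O →
      (∀ i, IsQuadraticTransformAlong O (A i) (A (i + 1))) →
      IsDiscreteValuationRing ↥O ∧ ∃ c, A c = O.toSubring)
    (P : ∀ B : Subalgebra k K, Ideal ↥B → ℕ → Prop) (N : ℕ)
    (hP : ∀ (B : Subalgebra k K) (m : Ideal ↥B), m.IsMaximal → P B m N)
    (hdim : ∀ B : Subalgebra k K, ringKrullDim ↥B ≤ 1)
    (B₀ : Subalgebra k K) (hB₀ : B₀.FG)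
    (hfrac : ∀ z : K, ∃ a ∈ B₀, ∃ b ∈ B₀, b ≠ 0 ∧ z = a / b)
    (O : ValuationSubring K) (hB₀O : B₀.toSubring ≤ O.toSubring) (hO : O ≠ ⊤) :
    ∃ (x : ℕ → K) (t : ℕ),
      (∀ s, s < t →
        risoValid P O (risoStage P B₀ ((List.range t).map fun _ => N) x s) N (x s)) ∧
      IsRegularLocalRing
        ↥(risoLoc O (risoStage P B₀ ((List.range t).map fun _ => N) x t)) := by
  classical
  -- an admissible denominator for every finitely generated chart inside `O`
  have hsel : ∀ B : Subalgebra k K, ∃ xt : K,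
      B.FG → B.toSubring ≤ O.toSubring → risoValid P O B N xt := by
    intro B
    by_cases hB : B.FG ∧ B.toSubring ≤ O.toSubring
    · obtain ⟨xt, hxt⟩ := rcr_exists_risoValid P O B hB.1 hB.2 N
      exact ⟨xt, fun _ _ => hxt⟩
    · exact ⟨0, fun h1 h2 => absurd ⟨h1, h2⟩ hB⟩
  choose xsel hxsel using hsel
  -- the recursive tower `T 0 = B₀`, `T (t+1) = (T t)[Cen/xsel (T t)]`
  obtain ⟨T, hT0, hTs⟩ : ∃ T : ℕ → Subalgebra k K,
      T 0 = B₀ ∧ ∀ t, T (t + 1) = risoStep P (T t) N (xsel (T t)) :=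
    ⟨fun t => Nat.rec (motive := fun _ => Subalgebra k K) B₀
      (fun _ B => risoStep P B N (xsel B)) t, rfl, fun _ => rfl⟩
  have hinv : ∀ t, (T t).FG ∧ (T t).toSubring ≤ O.toSubring := by
    intro t
    induction t with
    | zero => rw [hT0]; exact ⟨hB₀, hB₀O⟩
    | succ t ih =>
      rw [hTs t]
      exact ⟨risoStep_fg ih.1 _ _, risoStep_toSubring_le ih.2 (hxsel _ ih.1 ih.2)⟩
  obtain ⟨x, hx⟩ : ∃ x : ℕ → K, ∀ t, x t = xsel (T t) := ⟨_, fun _ => rfl⟩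
  have hval : ∀ t, risoValid P O (T t) N (x t) := fun t => by
    rw [hx]; exact hxsel (T t) (hinv t).1 (hinv t).2
  -- the stages along the constant word `N` with denominators `x` are the `T s`
  have hstage : ∀ t s, s ≤ t →
      risoStage P B₀ ((List.range t).map fun _ => N) x s = T s := by
    intro t s
    induction s with
    | zero => intro; rw [risoStage_zero, hT0]
    | succ s ih =>
      intro hs
      have hs' : s < ((List.range t).map fun _ => N).length := by
        rw [List.length_map, List.length_range]; exact hs
      have hget : ((List.range t).map fun _ => N).getD s 0 = N := by
        rw [reduction_getD_map_range (fun _ => N) (show s < t from hs)]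
      rw [risoStage_succ P B₀ _ x hs', ih (Nat.le_of_succ_le hs), hget, hTs s, hx s]
  -- some `T t` has a regular local ring at the centre of `O`
  have hex : ∃ t, IsRegularLocalRing ↥(risoLoc O (T t)) := by
    by_contra hall
    push Not at hall
    obtain ⟨A, hA⟩ : ∃ A : ℕ → Subring K, ∀ t, A t = (risoLoc O (T t)).toSubring :=
      ⟨_, fun _ => rfl⟩
    have hA0 : A 0 = locAtCentre B₀.toSubring O := by
      rw [hA, hT0]; exact risoLoc_toSubring_eq hB₀O
    have hAstep : ∀ i, IsQuadraticTransformAlong O (A i) (A (i + 1)) := fun i => by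
      rw [hA, hA, hTs i, ← hx i]
      exact hStep P N (T i) (hinv i).1 (hdim (T i)) (hP (T i)) O (hinv i).2 (hall i) (x i)
        (hval i)
    obtain ⟨hdvr, c, hc⟩ := hReach B₀ hB₀ hfrac (hdim B₀) O hB₀O hO A hA0 hAstep
    rw [hA] at hc
    haveI : IsDiscreteValuationRing ↥O := hdvr
    have hmemc : ∀ y : K, y ∈ risoLoc O (T c) ↔ y ∈ O := fun y => SetLike.ext_iff.mp hc y
    let e : ↥(risoLoc O (T c)) ≃+* ↥O :=
      { toFun := fun y => ⟨y.1, (hmemc y.1).mp y.2⟩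
        invFun := fun y => ⟨y.1, (hmemc y.1).mpr y.2⟩
        left_inv := fun _ => rfl
        right_inv := fun _ => rfl
        map_mul' := fun _ _ => rfl
        map_add' := fun _ _ => rfl }
    exact hall c (IsRegularLocalRing.of_ringEquiv e.symm)
  obtain ⟨t, ht⟩ := hex
  refine ⟨x, t, fun s hs => ?_, ?_⟩
  · rw [hstage t s hs.le]; exact hval s
  · rw [hstage t t le_rfl]; exact ht

/-- **Riso local uniformization for curves, generic in the cut predicate.** For a cut predicate
`P` holding at every maximal ideal for the letter `N`, a presentation `K = k(hᵢ/hⱼ)` by `N + 1`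
nonzero elements with `trdeg_k K ≤ 1`, and a valuation ring `O ⊇ k`: some chart `k[hᵢ/hⱼ] ⊆ O`
and some admissible chart path of the tower along the constant word `N` reach a regular local
ring at the centre of `O`. [folklore] -/
theorem curveAssembly_generic [IsAlgClosed k]
    (hStep : ∀ (P : ∀ B : Subalgebra k K, Ideal ↥B → ℕ → Prop) (d : ℕ)
      (B : Subalgebra k K), B.FG → ringKrullDim ↥B ≤ 1 →
      (∀ m : Ideal ↥B, m.IsMaximal → P B m d) →
      ∀ (O : ValuationSubring K), B.toSubring ≤ O.toSubring →
      ¬ IsRegularLocalRing ↥(risoLoc O B) → ∀ xt : K, risoValid P O B d xt →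
      IsQuadraticTransformAlong O (risoLoc O B).toSubring
        (risoLoc O (risoStep P B d xt)).toSubring)
    (hReach : ∀ (B : Subalgebra k K), B.FG →
      (∀ z : K, ∃ a ∈ B, ∃ b ∈ B, b ≠ 0 ∧ z = a / b) → ringKrullDim ↥B ≤ 1 →
      ∀ (O : ValuationSubring K), B.toSubring ≤ O.toSubring → O ≠ ⊤ →
      ∀ A : ℕ → Subring K, A 0 = locAtCentre B.toSubring O →
      (∀ i, IsQuadraticTransformAlong O (A i) (A (i + 1))) →
      IsDiscreteValuationRing ↥O ∧ ∃ c, A c = O.toSubring)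
    (P : ∀ B : Subalgebra k K, Ideal ↥B → ℕ → Prop) (N : ℕ)
    (hP : ∀ (B : Subalgebra k K) (m : Ideal ↥B), m.IsMaximal → P B m N)
    (h : Fin (N + 1) → K) (hh : ∀ i, h i ≠ 0)
    (hgen : IntermediateField.adjoin k
      (Set.range fun ij : Fin (N + 1) × Fin (N + 1) => h ij.1 * (h ij.2)⁻¹) = ⊤)
    (htr : Algebra.trdeg k K ≤ 1) (O : ValuationSubring K)
    (hk : ∀ c : k, algebraMap k K c ∈ O) :
    ∃ (j : Fin (N + 1)) (x : ℕ → K) (t : ℕ), (∀ i, h i * (h j)⁻¹ ∈ O) ∧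
      (∀ s, s < t → risoValid P O
        (risoStage P (Algebra.adjoin k (Set.range fun i => h i * (h j)⁻¹))
          ((List.range t).map fun _ => N) x s) N (x s)) ∧
      IsRegularLocalRing ↥(risoLoc O
        (risoStage P (Algebra.adjoin k (Set.range fun i => h i * (h j)⁻¹))
          ((List.range t).map fun _ => N) x t)) := by
  obtain ⟨j, hj⟩ := curveAssembly_exists_chart O h hh
  have hB₀O := chart_toSubring_le hk h j hj
  by_cases hO : O = ⊤
  · subst hO
    exact ⟨j, fun _ => 0, 0, hj, fun s hs => absurd hs (Nat.not_lt_zero s),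
      curveAssembly_regular_top _⟩
  · obtain ⟨x, t, hV, hreg⟩ := curveAssembly_tower hStep hReach P N hP
      (curveAssembly_ringKrullDim_le htr) _ (curveAssembly_chart_fg h j)
      (curveAssembly_frac h hh hgen j) O hB₀O hO
    exact ⟨j, x, t, hj, hV, hreg⟩

end Generic

/-! ## The stub -/

/-- **Stub (curves, assembly).** From the step and the termination lemmas: riso local
uniformization along the top word for presentations of transcendence degree `≤ 1` (chart of
minimal value; recursively chosen admissible denominators; if every stage were singular the
local rings would form an infinite quadratic sequence along `O`, which reaches the regular `O`). -/
theorem stub_rcrCurveAssembly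
    (hStep : ∀ {k K : Type} [Field k] [IsAlgClosed k] [Field K] [Algebra k K]
      (P : ∀ B : Subalgebra k K, Ideal ↥B → ℕ → Prop) (d : ℕ)
      (B : Subalgebra k K), B.FG → ringKrullDim ↥B ≤ 1 →
      (∀ m : Ideal ↥B, m.IsMaximal → P B m d) →
      ∀ (O : ValuationSubring K), B.toSubring ≤ O.toSubring →
      ¬ IsRegularLocalRing ↥(risoLoc O B) → ∀ xt : K, risoValid P O B d xt →
      IsQuadraticTransformAlong O (risoLoc O B).toSubring
        (risoLoc O (risoStep P B d xt)).toSubring)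
    (hReach : ∀ {k K : Type} [Field k] [Field K] [Algebra k K] (B : Subalgebra k K), B.FG →
      (∀ z : K, ∃ a ∈ B, ∃ b ∈ B, b ≠ 0 ∧ z = a / b) → ringKrullDim ↥B ≤ 1 →
      ∀ (O : ValuationSubring K), B.toSubring ≤ O.toSubring → O ≠ ⊤ →
      ∀ A : ℕ → Subring K, A 0 = locAtCentre B.toSubring O →
      (∀ i, IsQuadraticTransformAlong O (A i) (A (i + 1))) →
      IsDiscreteValuationRing ↥O ∧ ∃ c, A c = O.toSubring) :
    ∀ p : ℕ, p.Prime → ∀ (k : Type) [Field k] [CharP k p] [IsAlgClosed k]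
    (K : Type) [Field K] [Algebra k K] (N : ℕ) (h : Fin (N + 1) → K), (∀ i, h i ≠ 0) →
    IntermediateField.adjoin k
      (Set.range fun ij : Fin (N + 1) × Fin (N + 1) => h ij.1 * (h ij.2)⁻¹) = ⊤ →
    Algebra.trdeg k K ≤ 1 →
    ∃ w : ℕ → ℕ, ∀ O : ValuationSubring K, (∀ c : k, algebraMap k K c ∈ O) →
      ∃ (j : Fin (N + 1)) (x : ℕ → K) (t : ℕ), (∀ i, h i * (h j)⁻¹ ∈ O) ∧
        (∀ s, s < t → risoValid (fun (B : Subalgebra k K) (m : Ideal ↥B) (d : ℕ) => ¬ ∃ (n : ℕ) (g : Fin n → ↥B),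
        (∀ i, g i ∈ m) ∧ Algebra.adjoin k (Set.range fun i => (g i : K)) = B ∧
        ∃ W : Submodule k (Fin n → k), d + 1 ≤ Module.finrank k ↥W ∧
        ∃ φ : {α : ↥B →ₐ[k] HahnSeries ℚ k // ∀ b ∈ m, 0 < (α b).orderTop} → (Fin n → HahnSeries ℚ k),
          (∀ a b : {α : ↥B →ₐ[k] HahnSeries ℚ k // ∀ b ∈ m, 0 < (α b).orderTop}, a ≠ b →
            ∃ j, ∀ i, (a.1 (g j) - b.1 (g j)).orderTop <
              ((φ a i - φ b i) - (a.1 (g i) - b.1 (g i))).orderTop) ∧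
          (∀ a i, 0 < (φ a i).orderTop) ∧
          (∀ a, ∀ w : Fin n → HahnSeries ℚ k, (∀ i, 0 < (w i).orderTop) →
            w ∈ Submodule.span (HahnSeries ℚ k)
              ((fun u : Fin n → k => fun i => HahnSeries.C (u i)) '' (W : Set (Fin n → k))) →
              ∃ b, φ b = φ a + w)) O
          (risoStage (fun (B : Subalgebra k K) (m : Ideal ↥B) (d : ℕ) => ¬ ∃ (n : ℕ) (g : Fin n → ↥B),
        (∀ i, g i ∈ m) ∧ Algebra.adjoin k (Set.range fun i => (g i : K)) = B ∧
        ∃ W : Submodule k (Fin n → k), d + 1 ≤ Module.finrank k ↥W ∧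
        ∃ φ : {α : ↥B →ₐ[k] HahnSeries ℚ k // ∀ b ∈ m, 0 < (α b).orderTop} → (Fin n → HahnSeries ℚ k),
          (∀ a b : {α : ↥B →ₐ[k] HahnSeries ℚ k // ∀ b ∈ m, 0 < (α b).orderTop}, a ≠ b →
            ∃ j, ∀ i, (a.1 (g j) - b.1 (g j)).orderTop <
              ((φ a i - φ b i) - (a.1 (g i) - b.1 (g i))).orderTop) ∧
          (∀ a i, 0 < (φ a i).orderTop) ∧
          (∀ a, ∀ w : Fin n → HahnSeries ℚ k, (∀ i, 0 < (w i).orderTop) →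
            w ∈ Submodule.span (HahnSeries ℚ k)
              ((fun u : Fin n → k => fun i => HahnSeries.C (u i)) '' (W : Set (Fin n → k))) →
              ∃ b, φ b = φ a + w)) (Algebra.adjoin k (Set.range fun i => h i * (h j)⁻¹))
            ((List.range t).map w) x s) (w s) (x s)) ∧
        IsRegularLocalRing ↥(risoLoc O
          (risoStage (fun (B : Subalgebra k K) (m : Ideal ↥B) (d : ℕ) => ¬ ∃ (n : ℕ) (g : Fin n → ↥B),
        (∀ i, g i ∈ m) ∧ Algebra.adjoin k (Set.range fun i => (g i : K)) = B ∧
        ∃ W : Submodule k (Fin n → k), d + 1 ≤ Module.finrank k ↥W ∧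
        ∃ φ : {α : ↥B →ₐ[k] HahnSeries ℚ k // ∀ b ∈ m, 0 < (α b).orderTop} → (Fin n → HahnSeries ℚ k),
          (∀ a b : {α : ↥B →ₐ[k] HahnSeries ℚ k // ∀ b ∈ m, 0 < (α b).orderTop}, a ≠ b →
            ∃ j, ∀ i, (a.1 (g j) - b.1 (g j)).orderTop <
              ((φ a i - φ b i) - (a.1 (g i) - b.1 (g i))).orderTop) ∧
          (∀ a i, 0 < (φ a i).orderTop) ∧
          (∀ a, ∀ w : Fin n → HahnSeries ℚ k, (∀ i, 0 < (w i).orderTop) →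
            w ∈ Submodule.span (HahnSeries ℚ k)
              ((fun u : Fin n → k => fun i => HahnSeries.C (u i)) '' (W : Set (Fin n → k))) →
              ∃ b, φ b = φ a + w)) (Algebra.adjoin k (Set.range fun i => h i * (h j)⁻¹))
            ((List.range t).map w) x t)) := by
  intro p _ k _ _ _ K _ _ N h hh hgen htr
  refine ⟨fun _ => N, fun O hk => ?_⟩
  refine curveAssembly_generic hStep hReach _ N ?_ h hh hgen htr O hk
  intro B m hm
  exact hidden_cut_of_le N h hh hgen B m hm le_rfl

end Summit.ResolutionOfSingularities.ResolutionOfSingularities.Theorems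

end
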